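import Summits.CriticalPhenomena.PercolationContinuityZ3.Theorems.PercNearOneGluingNoHeavyLowerTailIncStarBernsteinRatio
import Summits.CriticalPhenomena.PercolationContinuityZ3.Theorems.PercNearOneGluingNoHeavyLowerTailIncStarPairConcavity
import HarnessLib

/-!
# The ratio chain collapses: along a root pair, `3c₂ ≥ 2c₃` ALONE gives the increasing star

Support file for the Sahi programme (`--supports stmt-CriticalPhenomena-4575`, prover prim-sahi-p2 gen 30).  No definitions, no named facts, no
sorries; standard axioms.  Memo `run/shared/lean/prim/prim-sahi/FROM-prim-sahi-p2-gen30-VERTEX-INDUCTION-LIGHT-STEP.md` §9–§13, `prim-sahi-p2/PROOF-E3.md` §40 (40q).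

Along a pair `e` with `P⁰ = P_{w[e↦0]}`, `P¹ = P_{w[e↦1]}`, Sahi's cubic `E₃(P_{w[e↦p]}; A,B,C)` of three events is the Bernstein cubic with
coefficients `c₀ = E₃(P⁰)`, `c₁ = polar₁(P⁰,P¹)`, `c₂ = polar₁(P¹,P⁰)`, `c₃ = E₃(P¹)` (`EdgeInduction.sahiE3_oneBond`).  In power form
`E₃(P_{w[e↦p]}) = c₀ + L·p − K·p² + D·p³` and this file identifies the LEADING coefficient:

* the leading coefficient is gen 16's third difference `c₃ − 3c₂ + 3c₁ − c₀ = δ_A δ_B δ_C` (`EdgeInduction.polar₁_third_diff`, nonnegative for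
  increasing events: `EdgeInduction.second_diff_zero_le_one`) — `D ≥ 0`;
* `ratio12_of_ratio23` — for reals with `c₀ ≥ 0` and `c₃ − 3c₂ + 3c₁ − c₀ ≥ 0`: `3c₂ ≥ 2c₃ ⟹ 2c₁ ≥ c₂`, because
  `3(2c₁ − c₂) = (3c₂ − 2c₃) + 2(c₃ − 3c₂ + 3c₁ − c₀) + 2c₀`.  So of gen 30's two ratio inequalities R12 (`2c₁ ≥ c₂`, census W145's 'P2') and
  R23 (`3c₂ ≥ 2c₃`) the first is implied by the second;
* `rem_of_ratio23` — with `h(p) = f(p) − p·f′(p) = c₀ + K p² − 2D p³` one has `min_{[0,1]} h = min(c₀, 3c₂ − 2c₃)`: R23 and `c₀ ≥ 0` already give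
  `p·f′(p) ≤ f(p)` on `[0,1]` (`f(p)/p` non-increasing), stated as the polynomial inequality;
* **`incStar_nonneg_of_ratio23`** — the increasing star on every finite weighted graph from R23 ALONE along fractional root–unmarked pairs
  (given the strong induction hypothesis), via `IncStar.incStar_nonneg_of_bernsteinRatio`.

So the open crux of the ratio route is the single inequality `3·polar₁(P¹,P⁰) ≥ 2·E₃(P¹)` for the star events along root–unmarked pairs; in
pivotal form (memo §13): `E₃(P⁰) + Σ_t δ_t·δ_{jk} ≥ Σ_t P⁰(A_t)·δ_j·δ_k + 2·δ_b δ_c δ_y` with `δ_X = P¹(X) − P⁰(X)`.  Nothing here asserts it.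
-/

noncomputable section

namespace Summit.CriticalPhenomena.PercolationContinuityZ3.Theorems

namespace IncStar

open MeasureTheory Set Literature.Probability.Percolation Literature.Probability.LatticeModels EdgeInduction
open scoped Classical

variable {n : ℕ}

/-- **R23 implies R12.**  For reals with `c₀ ≥ 0` and nonnegative leading coefficient `c₃ − 3c₂ + 3c₁ − c₀ ≥ 0`: `3c₂ ≥ 2c₃ ⟹ 2c₁ ≥ c₂`
(`3(2c₁ − c₂) = (3c₂ − 2c₃) + 2(c₃ − 3c₂ + 3c₁ − c₀) + 2c₀`). [this work] -/
theorem ratio12_of_ratio23 {c₀ c₁ c₂ c₃ : ℝ} (h0 : 0 ≤ c₀) (hD : 0 ≤ c₃ - 3 * c₂ + 3 * c₁ - c₀) (h23 : 2 * c₃ ≤ 3 * c₂) :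
    c₂ ≤ 2 * c₁ := by
  linarith

/-- **R23 gives the whole monotonicity of `f(p)/p`.**  For a cubic with Bernstein coefficients `c₀ ≥ 0, c₁, c₂, c₃`, nonnegative leading
coefficient and `3c₂ ≥ 2c₃`: `p·f′(p) ≤ f(p)` for `p ∈ [0,1]` — indeed `f(p) − p f′(p) = c₀ + K p² − 2D p³` with `K = 6c₁ − 3c₀ − 3c₂`,
`D = c₃ − 3c₂ + 3c₁ − c₀ ≥ 0`, whose minimum over `[0,1]` is `min(c₀, c₀ + K − 2D) = min(c₀, 3c₂ − 2c₃)`. [this work] -/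
theorem rem_of_ratio23 {p c₀ c₁ c₂ c₃ : ℝ} (hp0 : 0 ≤ p) (hp1 : p ≤ 1) (h0 : 0 ≤ c₀) (hD : 0 ≤ c₃ - 3 * c₂ + 3 * c₁ - c₀)
    (h23 : 2 * c₃ ≤ 3 * c₂) :
    p * (3 * ((1 - p) ^ 2 * (c₁ - c₀) + 2 * p * (1 - p) * (c₂ - c₁) + p ^ 2 * (c₃ - c₂))) ≤
      (1 - p) ^ 3 * c₀ + 3 * p * (1 - p) ^ 2 * c₁ + 3 * p ^ 2 * (1 - p) * c₂ + p ^ 3 * c₃ := by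
  -- h(p) = c₀ + K p² − 2 D p³,  K = 6c₁ − 3c₀ − 3c₂,  D = c₃ − 3c₂ + 3c₁ − c₀
  have key : (1 - p) ^ 3 * c₀ + 3 * p * (1 - p) ^ 2 * c₁ + 3 * p ^ 2 * (1 - p) * c₂ + p ^ 3 * c₃
      - p * (3 * ((1 - p) ^ 2 * (c₁ - c₀) + 2 * p * (1 - p) * (c₂ - c₁) + p ^ 2 * (c₃ - c₂)))
      = c₀ + (6 * c₁ - 3 * c₀ - 3 * c₂) * p ^ 2 - 2 * (c₃ - 3 * c₂ + 3 * c₁ - c₀) * p ^ 3 := by ring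
  -- case split on the sign of K − 2D = (3c₂ − 2c₃) − c₀... handled uniformly: h(p) ≥ (1 − p²)·c₀·[...]; use the two-piece bound
  -- h(p) = (1 − p²) c₀ + p² (c₀ + K − 2D) + 2 D p² (1 − p) ≥ 0
  have key2 : c₀ + (6 * c₁ - 3 * c₀ - 3 * c₂) * p ^ 2 - 2 * (c₃ - 3 * c₂ + 3 * c₁ - c₀) * p ^ 3
      = (1 - p ^ 2) * c₀ + p ^ 2 * (3 * c₂ - 2 * c₃) + 2 * (c₃ - 3 * c₂ + 3 * c₁ - c₀) * (p ^ 2 * (1 - p)) := by ring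
  have hp2 : 0 ≤ 1 - p ^ 2 := by nlinarith
  have h23' : 0 ≤ 3 * c₂ - 2 * c₃ := by linarith
  have hq : 0 ≤ p ^ 2 * (1 - p) := mul_nonneg (sq_nonneg p) (sub_nonneg.2 hp1)
  nlinarith [mul_nonneg hp2 h0, mul_nonneg (sq_nonneg p) h23', mul_nonneg hD hq, key, key2]

/-- **THE INCREASING STAR FROM R23 ALONE.**  Suppose that for every weight `w`, all markings `s b c y`, every unmarked `z ∉ {s,b,c,y}` with
`e = s(s,z)` fractional — and GIVEN the increasing star for every weight with fewer fractional non-loop pairs and every marking — the Bernstein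
coefficients of the increasing star along `e` satisfy `3c₂ ≥ 2c₃`, i.e. `2·E₃(P_{w[e↦1]}) ≤ 3·polar₁(P_{w[e↦1]}, P_{w[e↦0]})`.  Then
`E₃({s↔b},{s↔c},{s↔y}) ≥ 0` under `prodBernoulli w` for every weight `w` on the pairs of `Fin n` and all `s b c y`.
(`2c₁ ≥ c₂` follows by `ratio12_of_ratio23` from `c₀ ≥ 0` — the induction hypothesis at `w[e↦0]` — and the nonnegative third difference
`EdgeInduction.second_diff_zero_le_one`; then `incStar_nonneg_of_bernsteinRatio`.) [this work] -/
theorem incStar_nonneg_of_ratio23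
    (hR : ∀ (w : Sym2 (Fin n) → unitInterval) (s b c y z : Fin n), z ≠ s → z ≠ b → z ≠ c → z ≠ y → s(s, z) ∈ fracEdges w →
      (∀ w' : Sym2 (Fin n) → unitInterval,
          ((fracEdges w').filter fun f => ¬ f.IsDiag).card < ((fracEdges w).filter fun f => ¬ f.IsDiag).card →
          ∀ s' b' c' y' : Fin n, 0 ≤ sahiE3 (prodBernoulli w') (openConn s' b') (openConn s' c') (openConn s' y')) →
      2 * sahiE3 (prodBernoulli (Function.update w s(s, z) 1)) (openConn s b) (openConn s c) (openConn s y) ≤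
        3 * polar₁ (prodBernoulli (Function.update w s(s, z) 1)) (prodBernoulli (Function.update w s(s, z) 0))
          (openConn s b) (openConn s c) (openConn s y)) :
    ∀ (w : Sym2 (Fin n) → unitInterval) (s b c y : Fin n),
      0 ≤ sahiE3 (prodBernoulli w) (openConn s b) (openConn s c) (openConn s y) := by
  refine incStar_nonneg_of_bernsteinRatio ?_
  intro w s b c y z hzs hzb hzc hzy he IH
  have hnd : ¬ (s(s, z) : Sym2 (Fin n)).IsDiag := by rw [Sym2.mk_isDiag_iff]; exact hzs.symm
  have h0 : 0 ≤ sahiE3 (prodBernoulli (Function.update w s(s, z) 0)) (openConn s b) (openConn s c) (openConn s y) :=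
    IH _ (card_fracEdges_update_lt w he hnd 0 (Or.inl rfl)) s b c y
  have h23 := hR w s b c y z hzs hzb hzc hzy he IH
  -- the leading coefficient `c₃ − 3c₂ + 3c₁ − c₀ = δ_b δ_c δ_y ≥ 0` (gen 16, `EdgeInduction.second_diff_zero_le_one`)
  have hD := second_diff_zero_le_one w s(s, z) (isUpperSet_openConn s b) (isUpperSet_openConn s c) (isUpperSet_openConn s y)
  refine ⟨h23, ratio12_of_ratio23 h0 ?_ h23⟩
  linarith

/-- The same with R23 assumed outright (no induction hypothesis handed to the step). [this work] -/
theorem incStar_nonneg_of_ratio23'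
    (hR : ∀ (w : Sym2 (Fin n) → unitInterval) (s b c y z : Fin n), z ≠ s → z ≠ b → z ≠ c → z ≠ y → s(s, z) ∈ fracEdges w →
      2 * sahiE3 (prodBernoulli (Function.update w s(s, z) 1)) (openConn s b) (openConn s c) (openConn s y) ≤
        3 * polar₁ (prodBernoulli (Function.update w s(s, z) 1)) (prodBernoulli (Function.update w s(s, z) 0))
          (openConn s b) (openConn s c) (openConn s y)) :
    ∀ (w : Sym2 (Fin n) → unitInterval) (s b c y : Fin n),
      0 ≤ sahiE3 (prodBernoulli w) (openConn s b) (openConn s c) (openConn s y) :=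
  incStar_nonneg_of_ratio23 fun w s b c y z hzs hzb hzc hzy he _ => hR w s b c y z hzs hzb hzc hzy he

/-- **(CO) from R23 alone**: for any weight `w`, pair `e` and increasing events `A, B, C` with `E₃(P_{w[e↦0]}) ≥ 0` and
`2·E₃(P¹) ≤ 3·polar₁(P¹,P⁰)`: `w(e)·E₃(P_{w[e↦1]}) ≤ E₃(P_w)`. [this work] -/
theorem contractionChord_of_ratio23 (w : Sym2 (Fin n) → unitInterval) (e : Sym2 (Fin n)) {A B C : Set (BondConfig (Fin n))}
    (hA : IsUpperSet A) (hB : IsUpperSet B) (hC : IsUpperSet C)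
    (h0 : 0 ≤ sahiE3 (prodBernoulli (Function.update w e 0)) A B C)
    (h23 : 2 * sahiE3 (prodBernoulli (Function.update w e 1)) A B C ≤
      3 * polar₁ (prodBernoulli (Function.update w e 1)) (prodBernoulli (Function.update w e 0)) A B C) :
    (w e : ℝ) * sahiE3 (prodBernoulli (Function.update w e 1)) A B C ≤ sahiE3 (prodBernoulli w) A B C := by
  have hD := second_diff_zero_le_one w e hA hB hC
  exact contractionChord_of_bernsteinRatio w e A B C h0 h23 (ratio12_of_ratio23 h0 (by linarith) h23)

/-! ### Appendix (same session): R23 in PIVOTAL form -/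

/-- **THE INCREASING STAR FROM R23 IN PIVOTAL FORM.**  With `μ = P_{w[e↦0]}`, `ν = P_{w[e↦1]}`, `A,B,C = {s↔b},{s↔c},{s↔y}` and `δ_X = ν(X) − μ(X)` (the probability
that `e` is pivotal for `X`), gen 16's `EdgeInduction.polar₁_chordSlack_one` says `3c₂ − 2c₃ = E₃(μ) + Σ_cyc δ_A δ_{B∩C} − Σ_cyc μ(C) δ_A δ_B − 2 δ_A δ_B δ_C`.  Hence: if
along every fractional root–unmarked pair (strong induction hypothesis available)
`E₃(μ;A,B,C) + Σ_cyc δ_A δ_{B∩C} ≥ Σ_cyc μ(C) δ_A δ_B + 2 δ_A δ_B δ_C`,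
then the increasing star holds on every finite weighted graph (`incStar_nonneg_of_ratio23`). [this work] -/
theorem incStar_nonneg_of_pivotalR23
    (hP : ∀ (w : Sym2 (Fin n) → unitInterval) (s b c y z : Fin n), z ≠ s → z ≠ b → z ≠ c → z ≠ y → s(s, z) ∈ fracEdges w →
      (∀ w' : Sym2 (Fin n) → unitInterval,
          ((fracEdges w').filter fun f => ¬ f.IsDiag).card < ((fracEdges w).filter fun f => ¬ f.IsDiag).card →
          ∀ s' b' c' y' : Fin n, 0 ≤ sahiE3 (prodBernoulli w') (openConn s' b') (openConn s' c') (openConn s' y')) →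
      let μ := prodBernoulli (Function.update w s(s, z) 0)
      let ν := prodBernoulli (Function.update w s(s, z) 1)
      let A : Set (BondConfig (Fin n)) := openConn s b
      let B : Set (BondConfig (Fin n)) := openConn s c
      let C : Set (BondConfig (Fin n)) := openConn s y
      μ.real C * (ν.real A - μ.real A) * (ν.real B - μ.real B)
          + μ.real A * (ν.real B - μ.real B) * (ν.real C - μ.real C)
          + μ.real B * (ν.real A - μ.real A) * (ν.real C - μ.real C)
        + 2 * ((ν.real A - μ.real A) * (ν.real B - μ.real B) * (ν.real C - μ.real C)) ≤
      sahiE3 μ A B C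
        + ((ν.real A - μ.real A) * (ν.real (B ∩ C) - μ.real (B ∩ C))
          + (ν.real B - μ.real B) * (ν.real (A ∩ C) - μ.real (A ∩ C))
          + (ν.real C - μ.real C) * (ν.real (A ∩ B) - μ.real (A ∩ B)))) :
    ∀ (w : Sym2 (Fin n) → unitInterval) (s b c y : Fin n),
      0 ≤ sahiE3 (prodBernoulli w) (openConn s b) (openConn s c) (openConn s y) := by
  refine incStar_nonneg_of_ratio23 ?_
  intro w s b c y z hzs hzb hzc hzy he IH
  have h := hP w s b c y z hzs hzb hzc hzy he IH
  have hid := polar₁_chordSlack_one (prodBernoulli (Function.update w s(s, z) 0)) (prodBernoulli (Function.update w s(s, z) 1))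
    (openConn s b) (openConn s c) (openConn s y)
  simp only at h
  linarith

end IncStar

end Summit.CriticalPhenomena.PercolationContinuityZ3.Theorems

end
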